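import Mathlib.Data.ZMod.Basic
import Mathlib.Algebra.IsPrimePow
import Mathlib.Algebra.Order.Archimedean.Basic
import Mathlib.LinearAlgebra.Dimension.Free
import Mathlib.LinearAlgebra.Dimension.Constructions
import Mathlib.Analysis.SpecialFunctions.Pow.Real
import Literature.Combinatorics.Additive.TightTriangleRemoval
import HarnessLib

/-!
# The packing barrier of Pratt 2024, Cor. 2.10, is false as printed: a three-block STPP family

Topic `Literature/Combinatorics/Additive` (family `MatrixMultiplication`). Companion ("Proofs") file of
`TightTriangleRemoval.lean`, which vendors K. Pratt, *On generalized corners and matrix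
multiplication*, ITCS 2024 (arXiv:2309.03878), Cor. 2.10 as the named fact `Pratt2024_cor210`:
"∃ γ > 1, ∃ K, for every prime power `q`, every `ℓ` and every STPP family `(Aᵢ, Bᵢ, Cᵢ)_{i<N}` in
`(ℤ/q)^ℓ`, ONE OF THE THREE FULL packing sums `Σᵢ|Aᵢ||Bᵢ|`, `Σᵢ|Bᵢ||Cᵢ|`, `Σᵢ|Cᵢ||Aᵢ|` is at most
`K (q/γ)^ℓ`" (print, p. 6: "at least one of `Σ|Xᵢ||Yᵢ|, Σ|Xᵢ||Zᵢ|, Σ|Yᵢ||Zᵢ|` is at most `(q/C)^ℓ`",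
the case `K = 1`).

## Main result: `not_Pratt2024_cor210 : ¬ Pratt2024_cor210`

The statement is false, as vendored and as printed (Cor. 2.9, "one of the three sums is `o(n)`", is
false for the same reason). **Counterexample** (`threeBlockA/B/C`): in
`G = 𝔽₂³ × 𝔽₂³ × V`, `V = 𝔽₂ⁿ` (so `G ≅ 𝔽₂^{n+6}`), the three blocks
`(e₀ ⊕ 0 ⊕ V, {0}, {0 ⊕ e₀ ⊕ 0})`, `({e₁ ⊕ 0 ⊕ 0}, 0 ⊕ 0 ⊕ V, {0 ⊕ e₁ ⊕ 0})`,
`({e₂ ⊕ 0 ⊕ 0}, {0}, 0 ⊕ e₂ ⊕ V)` — one coset of `V` and two singletons per block, the coset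
sitting in a different role in each block — form an STPP family in the sense of
Cohn–Kleinberg–Szegedy–Umans 2005, Def. 5.1 (the tree's `IsSTPP`; all nine sets are nonempty, so
this is not an artefact of empty sets): each block is trivially TPP (two singletons and a coset of a
subgroup), and the cross sums `(Aᵢ − Bᵢ) + (Bⱼ − Cⱼ) + (C_k − A_k)` live in the coset
`σᵢ + τⱼ + υ_k + (0 ⊕ 0 ⊕ V)` with `σᵢ = eᵢ ⊕ 0`, `τⱼ = 0 ⊕ eⱼ`, `υ_k = e_k ⊕ e_k`, which contains `0`
only if `i = j = k` (a tricolored sum-free set of size `3` in `𝔽₂³ × 𝔽₂³`). But every one of the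
three packing sums is `2·2ⁿ + 1 > |G|/64`: no exponential saving `γ^{−ℓ}` is possible
(`not_Pratt2024_cor210`, choosing `n` with `γⁿ > 64K`, `q = 2`, `ℓ = n + 6`).

**Where the printed proof breaks** (Pratt 2024, proof of Cor. 2.9, p. 6): "For more than a `0.99`
fraction of the values of `i` we must have `|B₁ ∩ XᵢYᵢ⁻¹|/|XᵢYᵢ⁻¹| > 0.99` […] and similarly for the
other sets. Hence by the pigeonhole principle there is some `i` for which [all three densities exceed
`0.99`]". The "fraction of the values of `i`" is measured by three DIFFERENT weights
(`|Xᵢ||Yᵢ|/|A₁|`, `|Yᵢ||Zᵢ|/|A₂|`, `|Zᵢ||Xᵢ|/|A₃|`), and for lopsided families (as above) no common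
good `i` need exist: with `B₁ = A₀−B₀`-block of `A₁`, `B₂` = block `1` of `A₂`, `B₃` = block `2` of
`A₃` (densities `→ 1`) there is no solution of `b₁ + b₂ + b₃ = 0` at all.

## What the printed argument does prove (recorded, not asserted)

The single-block density argument (ibid.) is correct, and with a removal set `R` of size `εn`
killing all solutions it yields, block by block, that `R` contains a `1/100` fraction of one of the
three difference sets of EVERY block; hence the correct conclusion of Cor. 2.9 / 2.10 is the
**sum-of-minima form** `Σᵢ min(|Aᵢ||Bᵢ|, |Bᵢ||Cᵢ|, |Cᵢ||Aᵢ|) ≤ K (q/γ)^ℓ` (absolute `γ > 1`, `K`;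
all prime powers `q`, all `ℓ`). It is NOT asserted in this file (D-0026: no new unproved named
fact from a proving seat): it rests on tight arithmetic triangle removal in `(ℤ/q)^ℓ` — Fox–Lovász
2017 Thm. 1, printed for primes only (`FoxLovasz2017_thm1`), its prime-power extension being
asserted in Pratt's footnote 1 — plus the argument just described; the conditional derivation for
primes from `FoxLovasz2017_thm1` is the natural sequel. For the counterexample family the sum of
minima is `3` (`sum_min_threeBlock`). The sum-of-minima form gives back the printed disjunction for
UNIFORM families (`|Aᵢ|, |Bᵢ|, |Cᵢ|` independent of `i`, the case relevant to bounds on `ω`):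
`packing_disj_of_sum_min_le` (proved), and it suffices for Pratt's Thm. 4.4 (blockwise Hölder, at
the cost of a factor `3`).

## References

* [Pratt2024] K. Pratt, *On generalized corners and matrix multiplication*, ITCS 2024, LIPIcs 287,
  89:1–17; arXiv:2309.03878 — §2.1, Cor. 2.9 and its proof, Cor. 2.10 and footnote 1 (p. 6),
  Thm. 4.4 (p. 9).
* [CohnKleinbergSzegedyUmans2005] H. Cohn, R. Kleinberg, B. Szegedy, C. Umans, *Group-theoretic
  algorithms for matrix multiplication*, FOCS 2005 — Def. 5.1 (STPP).
* [FoxLovasz2017] J. Fox, L. M. Lovász, *A tight bound for Green's arithmetic triangle removal lemma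
  in vector spaces*, SODA 2017 — Thm. 1.
-/

noncomputable section

open Finset
open scoped BigOperators

namespace Literature.Combinatorics.Additive

open Literature.Computability.AlgebraicComplexity (IsSTPP)

/-! ### Transport of the STPP along injective homomorphisms -/

/-- **The STPP is preserved by injective additive homomorphisms** (applied set-wise): the defining
implication pulls back along `f` because `f` commutes with the six-term alternating sum and is
injective. (Dot-notation extension of the tree's `IsSTPP`, which lives in
`Literature/Computability/AlgebraicComplexity/GroupTheoreticMatMul.lean`.) [folklore] -/
theorem _root_.Literature.Computability.AlgebraicComplexity.IsSTPP.image {H H' F : Type*}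
    [AddCommGroup H] [AddCommGroup H'] [DecidableEq H'] [FunLike F H H'] [AddMonoidHomClass F H H']
    (f : F) (hf : Function.Injective f) {N : ℕ} {A B C : Fin N → Finset H} (h : IsSTPP A B C) :
    IsSTPP (fun i => (A i).image f) (fun i => (B i).image f) (fun i => (C i).image f) := by
  intro i j k s hs s' hs' t ht t' ht' u hu u' hu' heq
  simp only [Finset.mem_image] at hs hs' ht ht' hu hu'
  obtain ⟨s, hs, rfl⟩ := hs
  obtain ⟨s', hs', rfl⟩ := hs'
  obtain ⟨t, ht, rfl⟩ := ht
  obtain ⟨t', ht', rfl⟩ := ht'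
  obtain ⟨u, hu, rfl⟩ := hu
  obtain ⟨u', hu', rfl⟩ := hu'
  have heq' : (s' - s) + (t' - t) + (u' - u) = 0 := by
    apply hf
    simpa only [map_add, map_sub, map_zero] using heq
  obtain ⟨hij, hjk, hss, htt, huu⟩ := h i j k s hs s' hs' t ht t' ht' u hu u' hu' heq'
  exact ⟨hij, hjk, by rw [hss], by rw [htt], by rw [huu]⟩

/-! ### The three-block family in `𝔽₂³ × 𝔽₂³ × V` -/

section ThreeBlocks

variable (V : Type) [AddCommGroup V] [Fintype V] [DecidableEq V]

/-- Role pattern of the family: in block `i` exactly the `i`-th of the three sets is a full coset of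
`V`, the other two are singletons. `bigA i ⊆ V` is the `V`-part of `Aᵢ`: `V, {0}, {0}`. [folklore] -/
def bigA : Fin 3 → Finset V := ![Finset.univ, {0}, {0}]

/-- `V`-parts of `Bᵢ`: `{0}, V, {0}`. [folklore] -/
def bigB : Fin 3 → Finset V := ![{0}, Finset.univ, {0}]

/-- `V`-parts of `Cᵢ`: `{0}, {0}, V`. [folklore] -/
def bigC : Fin 3 → Finset V := ![{0}, {0}, Finset.univ]

/-- The embedding `v ↦ (eᵢ, 0, v)` carrying the `V`-part of `Aᵢ` into `𝔽₂³ × 𝔽₂³ × V`. [folklore] -/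
def embA (i : Fin 3) (v : V) : (Fin 3 → ZMod 2) × (Fin 3 → ZMod 2) × V := (Pi.single i 1, 0, v)

/-- The embedding `v ↦ (0, 0, v)` carrying the `V`-part of `Bⱼ`. [folklore] -/
def embB (v : V) : (Fin 3 → ZMod 2) × (Fin 3 → ZMod 2) × V := (0, 0, v)

/-- The embedding `v ↦ (0, e_k, v)` carrying the `V`-part of `C_k`. [folklore] -/
def embC (k : Fin 3) (v : V) : (Fin 3 → ZMod 2) × (Fin 3 → ZMod 2) × V := (0, Pi.single k 1, v)

/-- `Aᵢ = (eᵢ, 0) + bigA i`: `A₀ = (e₀,0) + V`, `A₁ = {(e₁,0,0)}`, `A₂ = {(e₂,0,0)}`. [folklore] -/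
def threeBlockA (i : Fin 3) : Finset ((Fin 3 → ZMod 2) × (Fin 3 → ZMod 2) × V) :=
  (bigA V i).image (embA V i)

/-- `Bⱼ = (0, 0) + bigB j`: `B₀ = {0}`, `B₁ = (0,0) + V`, `B₂ = {0}`. [folklore] -/
def threeBlockB (j : Fin 3) : Finset ((Fin 3 → ZMod 2) × (Fin 3 → ZMod 2) × V) :=
  (bigB V j).image (embB V)

/-- `C_k = (0, e_k) + bigC k`: `C₀ = {(0,e₀,0)}`, `C₁ = {(0,e₁,0)}`, `C₂ = (0,e₂) + V`. [folklore] -/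
def threeBlockC (k : Fin 3) : Finset ((Fin 3 → ZMod 2) × (Fin 3 → ZMod 2) × V) :=
  (bigC V k).image (embC V k)

/-- In `𝔽₂³`, `eᵢ = e_k` forces `i = k`. [folklore] -/
theorem fin3_eq_of_single_sub_single_eq_zero {i k : Fin 3}
    (h : (Pi.single i 1 : Fin 3 → ZMod 2) - Pi.single k 1 = 0) : i = k := by
  by_contra hne
  have h1 := congrFun h i
  rw [Pi.sub_apply, Pi.single_eq_same, Pi.single_eq_of_ne hne, Pi.zero_apply] at h1
  exact absurd h1 (by decide)

/-- **The three-block family is an STPP family** (CKSU Def. 5.1 = the tree's `IsSTPP`): the first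
two coordinates of the six-term sum read `eᵢ − e_k` and `e_k − eⱼ`, forcing `i = j = k`; inside one
block two of the three pairs are pairs of equal singletons, so the `V`-coordinate forces the third
pair to agree. [folklore] -/
theorem isSTPP_threeBlock : IsSTPP (threeBlockA V) (threeBlockB V) (threeBlockC V) := by
  intro i j k s hs s' hs' t ht t' ht' u hu u' hu' heq
  simp only [threeBlockA, threeBlockB, threeBlockC, Finset.mem_image] at hs hs' ht ht' hu hu'
  obtain ⟨v, hv, rfl⟩ := hs
  obtain ⟨v', hv', rfl⟩ := hs'
  obtain ⟨w, hw, rfl⟩ := ht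
  obtain ⟨w', hw', rfl⟩ := ht'
  obtain ⟨z, hz, rfl⟩ := hu
  obtain ⟨z', hz', rfl⟩ := hu'
  have h1 := congrArg Prod.fst heq
  have h2 := congrArg (fun x => x.2.1) heq
  have h3 := congrArg (fun x => x.2.2) heq
  simp only [embA, embB, embC, Prod.fst_add, Prod.fst_sub, Prod.snd_add, Prod.snd_sub, Prod.fst_zero,
    Prod.snd_zero, sub_zero, add_zero, zero_add] at h1 h2 h3
  have hik : i = k := fin3_eq_of_single_sub_single_eq_zero h1
  have hkj : k = j := fin3_eq_of_single_sub_single_eq_zero h2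
  subst hik
  subst hkj
  refine ⟨rfl, rfl, ?_⟩
  fin_cases i <;>
    simp only [bigA, bigB, bigC, Fin.zero_eta, Fin.mk_one, Fin.reduceFinMk, Fin.isValue,
      Matrix.cons_val_zero, Matrix.cons_val_one, Matrix.cons_val, Finset.mem_singleton,
      Finset.mem_univ] at hv hv' hw hw' hz hz' <;> subst_vars <;>
    simp only [sub_self, add_zero, zero_add, sub_eq_zero] at h3 <;> subst h3 <;> exact ⟨rfl, rfl, rfl⟩

omit [AddCommGroup V] [Fintype V] [DecidableEq V] in
/-- `v ↦ (eᵢ, 0, v)` is injective. [folklore] -/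
theorem embA_injective (i : Fin 3) : Function.Injective (embA V i) :=
  fun v w h => by simpa [embA] using congrArg (fun x => x.2.2) h

omit [AddCommGroup V] [Fintype V] [DecidableEq V] in
/-- `v ↦ (0, 0, v)` is injective. [folklore] -/
theorem embB_injective : Function.Injective (embB V) :=
  fun v w h => by simpa [embB] using congrArg (fun x => x.2.2) h

omit [AddCommGroup V] [Fintype V] [DecidableEq V] in
/-- `v ↦ (0, e_k, v)` is injective. [folklore] -/
theorem embC_injective (k : Fin 3) : Function.Injective (embC V k) :=
  fun v w h => by simpa [embC] using congrArg (fun x => x.2.2) h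

/-- `|A₀| = |V|`. [folklore] -/
theorem card_threeBlockA_zero : (threeBlockA V 0).card = Fintype.card V := by
  rw [threeBlockA, Finset.card_image_of_injective _ (embA_injective V 0)]
  simp [bigA]

/-- `|B₁| = |V|`. [folklore] -/
theorem card_threeBlockB_one : (threeBlockB V 1).card = Fintype.card V := by
  rw [threeBlockB, Finset.card_image_of_injective _ (embB_injective V)]
  simp [bigB]

/-- `|C₂| = |V|`. [folklore] -/
theorem card_threeBlockC_two : (threeBlockC V 2).card = Fintype.card V := by
  rw [threeBlockC, Finset.card_image_of_injective _ (embC_injective V 2)]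
  simp [bigC]

/-- `|B₀| = 1`. [folklore] -/
theorem card_threeBlockB_zero : (threeBlockB V 0).card = 1 := by
  simp [threeBlockB, bigB]

/-- `|C₁| = 1`. [folklore] -/
theorem card_threeBlockC_one : (threeBlockC V 1).card = 1 := by
  simp [threeBlockC, bigC]

/-- `|A₂| = 1`. [folklore] -/
theorem card_threeBlockA_two : (threeBlockA V 2).card = 1 := by
  simp [threeBlockA, bigA]

/-- First packing sum: `Σᵢ |Aᵢ||Bᵢ| ≥ |A₀||B₀| = |V|`. [folklore] -/
theorem card_le_sum_threeBlockAB :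
    Fintype.card V ≤ ∑ i, (threeBlockA V i).card * (threeBlockB V i).card := by
  calc Fintype.card V = (threeBlockA V 0).card * (threeBlockB V 0).card := by
        rw [card_threeBlockA_zero, card_threeBlockB_zero, mul_one]
    _ ≤ ∑ i, (threeBlockA V i).card * (threeBlockB V i).card :=
        Finset.single_le_sum (f := fun i => (threeBlockA V i).card * (threeBlockB V i).card)
          (fun _ _ => Nat.zero_le _) (Finset.mem_univ _)

/-- Second packing sum: `Σᵢ |Bᵢ||Cᵢ| ≥ |B₁||C₁| = |V|`. [folklore] -/
theorem card_le_sum_threeBlockBC :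
    Fintype.card V ≤ ∑ i, (threeBlockB V i).card * (threeBlockC V i).card := by
  calc Fintype.card V = (threeBlockB V 1).card * (threeBlockC V 1).card := by
        rw [card_threeBlockB_one, card_threeBlockC_one, mul_one]
    _ ≤ ∑ i, (threeBlockB V i).card * (threeBlockC V i).card :=
        Finset.single_le_sum (f := fun i => (threeBlockB V i).card * (threeBlockC V i).card)
          (fun _ _ => Nat.zero_le _) (Finset.mem_univ _)

/-- Third packing sum: `Σᵢ |Cᵢ||Aᵢ| ≥ |C₂||A₂| = |V|`. [folklore] -/
theorem card_le_sum_threeBlockCA :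
    Fintype.card V ≤ ∑ i, (threeBlockC V i).card * (threeBlockA V i).card := by
  calc Fintype.card V = (threeBlockC V 2).card * (threeBlockA V 2).card := by
        rw [card_threeBlockC_two, card_threeBlockA_two, mul_one]
    _ ≤ ∑ i, (threeBlockC V i).card * (threeBlockA V i).card :=
        Finset.single_le_sum (f := fun i => (threeBlockC V i).card * (threeBlockA V i).card)
          (fun _ _ => Nat.zero_le _) (Finset.mem_univ _)

/-- The sum of the blockwise MINIMA of the three pair products is `1 + 1 + 1 = 3` for this family:
the quantity the printed proof actually controls is tiny here. [folklore] -/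
theorem sum_min_threeBlock :
    ∑ i, min ((threeBlockA V i).card * (threeBlockB V i).card)
      (min ((threeBlockB V i).card * (threeBlockC V i).card)
        ((threeBlockC V i).card * (threeBlockA V i).card)) ≤ 3 := by
  have h0 : min ((threeBlockA V 0).card * (threeBlockB V 0).card)
      (min ((threeBlockB V 0).card * (threeBlockC V 0).card)
        ((threeBlockC V 0).card * (threeBlockA V 0).card)) ≤ 1 := by
    refine (min_le_right _ _).trans ((min_le_left _ _).trans ?_)
    rw [card_threeBlockB_zero, one_mul]
    simp [threeBlockC, bigC]
  have h1 : min ((threeBlockA V 1).card * (threeBlockB V 1).card)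
      (min ((threeBlockB V 1).card * (threeBlockC V 1).card)
        ((threeBlockC V 1).card * (threeBlockA V 1).card)) ≤ 1 := by
    refine (min_le_right _ _).trans ((min_le_right _ _).trans ?_)
    rw [card_threeBlockC_one, one_mul]
    simp [threeBlockA, bigA]
  have h2 : min ((threeBlockA V 2).card * (threeBlockB V 2).card)
      (min ((threeBlockB V 2).card * (threeBlockC V 2).card)
        ((threeBlockC V 2).card * (threeBlockA V 2).card)) ≤ 1 := by
    refine (min_le_left _ _).trans ?_
    rw [card_threeBlockA_two, one_mul]
    simp [threeBlockB, bigB]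
  rw [Fin.sum_univ_three]
  omega

end ThreeBlocks

/-! ### Refutation of the vendored (and printed) statement -/

/-- The arithmetic of the contradiction: if `γⁿ > 64K` (and `γ > 1`) then the claimed bound
`K (2/γ)^{n+6}` is below `2ⁿ = |V|`. [folklore] -/
theorem mul_div_pow_lt_two_pow {γ K : ℝ} (hγ : 1 < γ) {n : ℕ} (hn : 64 * K < γ ^ n) :
    K * ((2 : ℝ) / γ) ^ (n + 6) < (2 : ℝ) ^ n := by
  have hγ0 : 0 < γ := zero_lt_one.trans hγ
  rcases le_or_gt K 0 with hK | hK
  · calc K * ((2 : ℝ) / γ) ^ (n + 6) ≤ 0 := mul_nonpos_of_nonpos_of_nonneg hK (by positivity)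
      _ < (2 : ℝ) ^ n := by positivity
  · have hpow : γ ^ n ≤ γ ^ (n + 6) := pow_le_pow_right₀ hγ.le (by omega)
    have h64 : 64 * K < γ ^ (n + 6) := hn.trans_le hpow
    rw [div_pow, mul_div_assoc', div_lt_iff₀ (by positivity)]
    calc K * (2 : ℝ) ^ (n + 6) = (64 * K) * (2 : ℝ) ^ n := by ring
      _ < γ ^ (n + 6) * (2 : ℝ) ^ n := mul_lt_mul_of_pos_right h64 (by positivity)
      _ = (2 : ℝ) ^ n * γ ^ (n + 6) := by ring

/-- **Pratt 2024, Cor. 2.10 is false as stated** (and so is the vendored explicit-constants reading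
`Pratt2024_cor210` = route item `PrimePowerPackingBarrier` of
`MatrixMultiplication/EisensteinValCertificates`): for every `γ > 1` and every `K` there is an STPP
family in `(ℤ/2)^ℓ` (`ℓ = n + 6` with `γⁿ > 64K`; three blocks, all sets nonempty — the image of
`threeBlockA/B/C` under a linear isomorphism `𝔽₂³ × 𝔽₂³ × 𝔽₂ⁿ ≅ 𝔽₂^{n+6}`) all three of whose packing
sums `Σ|Aᵢ||Bᵢ|`, `Σ|Bᵢ||Cᵢ|`, `Σ|Cᵢ||Aᵢ|` exceed `K (2/γ)^ℓ` (each is `≥ 2ⁿ`). The gap in print is the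
pigeonhole step of the proof of Cor. 2.9 (three different weightings of the block index); the
argument proves only the sum-of-minima form (module docstring; `packing_disj_of_sum_min_le`).
[cite: Pratt2024, Cor. 2.10] -/
theorem not_Pratt2024_cor210 : ¬ Pratt2024_cor210 := by
  rintro ⟨γ, hγ, K, h⟩
  obtain ⟨n, hn⟩ := pow_unbounded_of_one_lt (64 * K) hγ
  -- coordinatise `𝔽₂³ × 𝔽₂³ × 𝔽₂ⁿ` as `𝔽₂^{n+6}`
  have hrank : Module.finrank (ZMod 2) ((Fin 3 → ZMod 2) × (Fin 3 → ZMod 2) × (Fin n → ZMod 2)) =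
      Module.finrank (ZMod 2) (Fin (n + 6) → ZMod 2) := by
    simp only [Module.finrank_prod, Module.finrank_fin_fun]
    omega
  set e := LinearEquiv.ofFinrankEq _ _ hrank with he_def
  have he : Function.Injective e := e.injective
  have hS := (isSTPP_threeBlock (Fin n → ZMod 2)).image e he
  have hmain := h 2 (n + 6) Nat.prime_two.isPrimePow 3 _ _ _ hS
  simp only [Finset.card_image_of_injective _ he] at hmain
  have hV : Fintype.card (Fin n → ZMod 2) = 2 ^ n := by simp
  have hlt := mul_div_pow_lt_two_pow hγ hn
  have cast2 : ((2 ^ n : ℕ) : ℝ) = (2 : ℝ) ^ n := by push_cast; ring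
  have hAB : (2 : ℝ) ^ n ≤ ∑ i, (((threeBlockA (Fin n → ZMod 2) i).card *
      (threeBlockB (Fin n → ZMod 2) i).card : ℕ) : ℝ) := by
    rw [← Nat.cast_sum, ← cast2, ← hV]
    exact_mod_cast card_le_sum_threeBlockAB (Fin n → ZMod 2)
  have hBC : (2 : ℝ) ^ n ≤ ∑ i, (((threeBlockB (Fin n → ZMod 2) i).card *
      (threeBlockC (Fin n → ZMod 2) i).card : ℕ) : ℝ) := by
    rw [← Nat.cast_sum, ← cast2, ← hV]
    exact_mod_cast card_le_sum_threeBlockBC (Fin n → ZMod 2)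
  have hCA : (2 : ℝ) ^ n ≤ ∑ i, (((threeBlockC (Fin n → ZMod 2) i).card *
      (threeBlockA (Fin n → ZMod 2) i).card : ℕ) : ℝ) := by
    rw [← Nat.cast_sum, ← cast2, ← hV]
    exact_mod_cast card_le_sum_threeBlockCA (Fin n → ZMod 2)
  have hq : ((2 : ℕ) : ℝ) = (2 : ℝ) := by norm_num
  rw [hq] at hmain
  rcases hmain with h1 | h2 | h3
  · exact absurd (hAB.trans h1) (not_le.2 hlt)
  · exact absurd (hBC.trans h2) (not_le.2 hlt)
  · exact absurd (hCA.trans h3) (not_le.2 hlt)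

/-! ### The corrected conclusion (sum of blockwise minima) and uniform families -/

/-- **From the sum-of-minima bound to the printed disjunction, for uniform families.** What the
printed proof of Pratt 2024, Cor. 2.9 / 2.10 controls is the sum over blocks of the MINIMUM of the
three pair products, `Σᵢ min(|Aᵢ||Bᵢ|, |Bᵢ||Cᵢ|, |Cᵢ||Aᵢ|)` (a removal set meets a fixed fraction of one
of the three difference sets of every block). For a **uniform** family (`|Aᵢ| = a`, `|Bᵢ| = b`,
`|Cᵢ| = c` for all `i` — the case relevant to bounds on `ω`) this sum is the minimum of the three full
packing sums, so any bound `M` on it is a bound on one of `Σ|Aᵢ||Bᵢ|`, `Σ|Bᵢ||Cᵢ|`, `Σ|Cᵢ||Aᵢ|`: the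
printed disjunction holds for uniform families whenever the sum-of-minima bound does. (Stated for
an arbitrary ambient type; no group structure is involved.) [cite: Pratt2024, Cor. 2.10 (proof)] -/
theorem packing_disj_of_sum_min_le {X : Type*} {N : ℕ} {A B C : Fin N → Finset X} {M : ℝ}
    (huni : ∃ a b c : ℕ, ∀ i, (A i).card = a ∧ (B i).card = b ∧ (C i).card = c)
    (hmin : ∑ i, ((min ((A i).card * (B i).card)
      (min ((B i).card * (C i).card) ((C i).card * (A i).card)) : ℕ) : ℝ) ≤ M) :
    (∑ i, (((A i).card * (B i).card : ℕ) : ℝ) ≤ M) ∨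
      (∑ i, (((B i).card * (C i).card : ℕ) : ℝ) ≤ M) ∨
      (∑ i, (((C i).card * (A i).card : ℕ) : ℝ) ≤ M) := by
  obtain ⟨a, b, c, habc⟩ := huni
  have hsum : ∑ i, ((min ((A i).card * (B i).card)
      (min ((B i).card * (C i).card) ((C i).card * (A i).card)) : ℕ) : ℝ) =
        ∑ _i : Fin N, ((min (a * b) (min (b * c) (c * a)) : ℕ) : ℝ) := by
    refine Finset.sum_congr rfl fun i _ => ?_
    rw [(habc i).1, (habc i).2.1, (habc i).2.2]
  have hAB : ∑ i, (((A i).card * (B i).card : ℕ) : ℝ) = ∑ _i : Fin N, ((a * b : ℕ) : ℝ) :=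
    Finset.sum_congr rfl fun i _ => by rw [(habc i).1, (habc i).2.1]
  have hBC : ∑ i, (((B i).card * (C i).card : ℕ) : ℝ) = ∑ _i : Fin N, ((b * c : ℕ) : ℝ) :=
    Finset.sum_congr rfl fun i _ => by rw [(habc i).2.1, (habc i).2.2]
  have hCA : ∑ i, (((C i).card * (A i).card : ℕ) : ℝ) = ∑ _i : Fin N, ((c * a : ℕ) : ℝ) :=
    Finset.sum_congr rfl fun i _ => by rw [(habc i).2.2, (habc i).1]
  rw [hsum] at hmin
  rcases le_total (a * b) (min (b * c) (c * a)) with h1 | h1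
  · left
    rw [hAB]
    simpa only [min_eq_left h1] using hmin
  · rw [min_eq_right h1] at hmin
    rcases le_total (b * c) (c * a) with h2 | h2
    · right; left
      rw [hBC]
      simpa only [min_eq_left h2] using hmin
    · right; right
      rw [hCA]
      simpa only [min_eq_right h2] using hmin

end Literature.Combinatorics.Additive

end
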